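import Summits.QuantumFields.YangMills.Theorems.LuscherReductionTwistedTraceScalingSoftTubeOn
import Summits.QuantumFields.YangMills.Theorems.TwistedTraceScaling.Negative.TubePackageRhoIffInner
import HarnessLib

/-!
# R34 — lane A g13's SUPPORT-SEPARATED targets `SoftTubeNoIntruderOn L χ S` / `SoftTubeBOPackageOn L χ S` (p644888, COARSE-DESIGN §24.3 «the region fix of record») are,
# AS TYPED, INNER one-orbit at the test radius `δ` — the weight `χ` (its radius `δ' ≥ δ`, fat radius `ρ`, gauge width `δg`) is DECORATIVE
# (crux disprover of `TwistedTraceScaling`, stmt-QuantumFields-20203, cycle 27; negative lane, `--supports`; def-free)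

Lane A's §24.3 separates the weight's support (`χ_big = recordWeightRho δ' ρ δg`, `δ' = 3δ`, `ρ = Mδ`, `M ≥ 6`) from the test functions' support `S = {orbitDist < δ}` and re-derives
C4-CORE: ★★★ `innerNoIntruderOneOrbitAt_of_softTubeOn`, ★★★ `softTubeNoIntruderOn_of_package`, ★★★ `innerNoIntruderOneOrbitAt_pow_of_bigRecordWeight_packageOn` — vetted EXACT.
THIS FILE closes the circle exactly as R27/R27b/R31 did for the unseparated targets (HANDOFF regime (j): instantiate the converses FIRST):
* §1 ★★ `softTubeNoIntruderOn_of_inner` — `InnerNoIntruderOneOrbitAt L δ → SoftTubeNoIntruderOn L χ S` for EVERY measurable, bounded, nonnegative weight bounded below on its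
  support and EVERY region with `supp χ ∩ S ⊆ {orbitDist < δ}` eventually; NO condition on the weight's own support radius (R27's proof verbatim: the tube form sees only
  `P f = gaugeAvg f` (`R27.tubeForm_eq_qform_gaugeAvg`), `‖Pf‖² ≤ ∫ f² N/χ` (`R27.l2_gaugeAvg_le_tubeNormSq`), and `P f` is supported in the gauge saturation of `supp f`).
* §2 ★★ `softTubeNoIntruderOn_iff_inner` (admissible `χ ≥ 0` bounded below on its support; `S = {orbitDist < δ}`).
* §3 ★ `softTubeBOPackageOn_of_softTubeNoIntruderOn` (the TRIVIAL SPLIT `u = f`, `v = 0`, `θ = 1`, `b = 0`, `σ = e^{ελ_b/4}λ₀/μ₀`, R18/R27b verbatim), ★ `softTubeBOPackageOn_iff`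
  (EVERY `χ`, EVERY `S`).
* §4 ★★ BY NAME, the targets of record: `softTubeOn_bigRecordWeightRho_iff_inner` / `softTubeBOPackageOn_bigRecordWeightRho_iff_inner` — for all positive `δ ≤ δ'`, all `ρ ≥ 2δ'`,
  ALL `δg`: `SoftTubeBOPackageOn L (recordWeightRho δ' ρ δg) {orbitDist < δ} ↔ SoftTubeNoIntruderOn L (recordWeightRho δ' ρ δg) {orbitDist < δ} ↔ InnerNoIntruderOneOrbitAt L δ`;
  ★★ `softTubeBOPackageOn_pow_iff (s t c M) (1 ≤ c) (2c ≤ M)` — the power-scale instance (`δ' = cβ^{−s}`, lane A's `c = 3`, `M ≥ 6`) is INNER at `powScale s` for EVERY `t, c, M`;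
  ★ `softTubeBOPackageOn_pow_iff_packageAt_recordWeightRho` / `…_iff_packageAt_recordWeight` / `…_iff_innerBOPackage` — the separated target is EQUIVALENT to the unseparated ones
  (R31, R27b) and to R18's `InnerBOPackageAt`: the support separation has 0 bytes of content in the typed target.
READING for lane A / OWNER / LEAD.  §24.3's boundary-layer defect (BO fibres truncated by the `ℓ¹` cut `orbitDist < δ` near its edge; STIFF with an `O(1)` gap false there along
the abelian valley) is a defect of ONE proof architecture (the fibrewise projection `P` onto `φ(u)Ω*(v)`), not of the target: the typed `…On` statements have the truth set of
INNER one-orbit at `δ` whatever `χ_big` is.  The separation is legitimate METHOD (it lets `P`'s range stay inside `supp χ_big`), and nothing in it can be attacked or defended at the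
level of statements; the disprover's standing targets remain the NAMED ingredients of the assembly §24.4 — (F)/(ST)/(OD) kernel-versus-model texts (regimes (l)–(n): R32/R33 flip
pairs, R33c on the slice), any whole-tube `hnear` (R19/R21), and the budgets (R18–R21, R25).  NO KILL; C4-CORE still has 0 typed bytes beyond INNER (R18/R27/R27b/R31/R34).
HONEST FRAMING: bookkeeping about the typed interface of stub S-BASE's sub-target C4 of a child of the CONDITIONAL reduction route R2b1; no kernel estimate refuted or proved;
C4 OPEN; not infinite volume, not a gap, not Clay.  Sorry-free, no new definition; axioms ⊆ {propext, Classical.choice, Quot.sound}.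

## References
* M. Lüscher, Some analytic results concerning the mass spectrum of Yang–Mills gauge theories on a torus, Nucl. Phys. B219 (1983) 233–261, §3. [Luscher1983]
* E. Seiler, Gauge Theories as a Problem of Constructive Quantum Field Theory and Statistical Mechanics, LNP 159 (1982), §2–3. [SeilerLNP1982]
-/

set_option autoImplicit false

noncomputable section

open MeasureTheory Filter Topology Real
open scoped BigOperators
open Literature.MathematicalPhysics.QuantumFieldTheory hiding SU2
open Literature.MathematicalPhysics.QuantumLattice
open Summit.QuantumFields.YangMills.Theorems.FemtoTransferGap
open Summit.QuantumFields.YangMills.Theorems.FemtoTransferGap.TwoLattice.Avg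
open Summit.QuantumFields.YangMills.Theorems.FemtoTransferGap.TwoLattice.ConstTube
open Summit.QuantumFields.YangMills.Theorems.TwistedTraceScaling.Negative.R27
open Summit.QuantumFields.YangMills.Theorems.TwistedTraceScaling.Negative.R27b
open Summit.QuantumFields.YangMills.Theorems.TwistedTraceScaling.Negative.R31

namespace Summit.QuantumFields.YangMills.Theorems.TwistedTraceScaling.Negative.R34

variable {L : ℕ} [NeZero L]

/-! ## §1 ★★ INNER one-orbit implies the support-separated soft tube statement — for every weight -/

/-- ★★ **`InnerNoIntruderOneOrbitAt L δ → SoftTubeNoIntruderOn L χ S`** for every weight `χ` that is measurable, bounded, nonnegative and bounded below on its support, and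
every region `S` with `supp (χ β) ∩ S β ⊆ {orbitDist < δ β}` eventually — NO condition on the support radius of `χ` itself.  Proof = `R27.softTubeNoIntruderAt_of_inner`
verbatim: INNER applied to the invariant family `gaugeAvg fᵢ` (same tube form, smaller norm, supported in the gauge saturation of `supp fᵢ ⊆ S β`); a degenerate invariant
Gram matrix yields a combination with `gaugeAvg f_a = 0` a.e., tube form `0`. [cite: Luscher1983, §3] [cite: SeilerLNP1982, §2–3] -/
theorem softTubeNoIntruderOn_of_inner {δ : ℝ → ℝ} {χ : ℝ → GaugeConfig 3 L SU2 → ℝ} {S : ℝ → Set (GaugeConfig 3 L SU2)}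
    (hχm : ∀ β, Measurable (χ β)) (hχb : ∀ β, ∃ C : ℝ, ∀ U, |χ β U| ≤ C) (hχ0 : ∀ β U, 0 ≤ χ β U)
    (hχlow : ∀ β, ∃ m : ℝ, 0 < m ∧ ∀ U, χ β U ≠ 0 → m ≤ χ β U)
    (hS : ∃ β1 : ℝ, ∀ β : ℝ, β1 ≤ β → ∀ U, χ β U ≠ 0 → U ∈ S β → orbitDist U < δ β)
    (hI : InnerNoIntruderOneOrbitAt L δ) : SoftTubeNoIntruderOn L χ S := by
  intro k ε hε
  obtain ⟨β0, hβ0⟩ := hI k ε hε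
  obtain ⟨β1, hβ1⟩ := hS
  refine ⟨max (max β0 β1) 0, fun β hβ f hfm hfb hfs hfS hGram => ?_⟩
  have hβ0' : β0 ≤ β := ((le_max_left _ _).trans (le_max_left _ _)).trans hβ
  have hβ1' : β1 ≤ β := ((le_max_right _ _).trans (le_max_left _ _)).trans hβ
  have hβpos : 0 ≤ β := (le_max_right _ _).trans hβ
  have hsβ : ∀ U, χ β U ≠ 0 → U ∈ S β → orbitDist U < δ β := hβ1 β hβ1'
  obtain ⟨Cχ, hCχ⟩ := hχb β
  obtain ⟨m, hm, hmχ⟩ := hχlow β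
  -- the invariant family
  set G : Fin (k + 1) → GaugeConfig 3 L SU2 → ℝ := fun i => gaugeAvg (f i) with hG
  have hGm : ∀ i, Measurable (G i) := fun i => measurable_gaugeAvg (hfm i)
  have hGb : ∀ i, ∃ C : ℝ, ∀ U, |G i U| ≤ C := fun i => by
    obtain ⟨C, hC⟩ := hfb i
    exact ⟨C, abs_gaugeAvg_le (hfm i) hC⟩
  have hGinv : ∀ i (g : Site 3 L → SU2) (U : GaugeConfig 3 L SU2), G i (gaugeTransform g U) = G i U :=
    fun i g U => gaugeAvg_gaugeTransform (f i) g U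
  have hGs : ∀ i U, G i U ≠ 0 → orbitDist U < δ β := fun i U hU => by
    by_contra hnot
    have hzero : ∀ g : Site 3 L → SU2, f i (gaugeTransform g U) = 0 := fun g => by
      by_contra h
      have h1 := hsβ _ (hfs i _ h) (hfS i _ h)
      rw [orbitDist_gaugeTransform] at h1
      exact hnot h1
    exact hU (gaugeAvg_eq_zero_of_forall hzero)
  -- combinations: the gauge average of `f_a` is `G_a`
  have hcomb : ∀ a : Fin (k + 1) → ℝ, gaugeAvg (fun V => ∑ i, a i * f i V) = fun U => ∑ i, a i * G i U :=
    fun a => funext fun U => gaugeAvg_combination hfm hfb a U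
  have hfs' : ∀ (a : Fin (k + 1) → ℝ) (U : GaugeConfig 3 L SU2), (∑ i, a i * f i U) ≠ 0 → χ β U ≠ 0 := fun a U hU => by
    obtain ⟨i, hi⟩ := exists_ne_zero_of_combination_ne_zero hU
    exact hfs i U hi
  have hform : ∀ a : Fin (k + 1) → ℝ,
      (∫ U, ∫ V, (∑ i, a i * f i U) * avgKernel β U V * (∑ i, a i * f i V) ∂configMeasure SU2 L ∂configMeasure SU2 L) =
        qform su2Rep β (fun U => ∑ i, a i * G i U) (fun U => ∑ i, a i * G i U) := fun a => by
    obtain ⟨C, hC⟩ := bounded_combination hfb a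
    have h := tubeForm_eq_qform_gaugeAvg β (measurable_combination hfm a) hC
    rw [hcomb a] at h
    exact h
  have hnorm : ∀ a : Fin (k + 1) → ℝ,
      l2 (fun U => ∑ i, a i * G i U) (fun U => ∑ i, a i * G i U) ≤ ∫ U, (∑ i, a i * f i U) ^ 2 * softWeight (χ β) U ∂configMeasure SU2 L := fun a => by
    obtain ⟨C, hC⟩ := bounded_combination hfb a
    have h := l2_gaugeAvg_le_tubeNormSq (hχm β) hCχ (hχ0 β) hm hmχ (measurable_combination hfm a) hC (hfs' a)
    rw [hcomb a] at h
    exact h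
  have hB : 0 ≤ (L : ℝ) ^ 3 * β := by positivity
  have hK : 0 ≤ Real.exp (ε * bareLambda ((L : ℝ) ^ 3 * β)) * levelValue su2Rep 1 ((L : ℝ) ^ 3 * β) k * levelValue su2Rep L β 0 :=
    mul_nonneg (mul_nonneg (Real.exp_pos _).le (levelValue_su2Rep_nonneg 1 hB k)) (levelValue_zero_su2Rep_pos L β).le
  by_cases hdeg : ∀ a : Fin (k + 1) → ℝ, a ≠ 0 → 0 < l2 (fun U => ∑ i, a i * G i U) (fun U => ∑ i, a i * G i U)
  · -- nondegenerate invariant Gram matrix: INNER applies to `G`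
    obtain ⟨a, ha, hle⟩ := hβ0 β hβ0' G hGm hGb hGinv hGs hdeg
    refine ⟨a, ha, ?_⟩
    rw [hform a]
    exact hle.trans (mul_le_mul_of_nonneg_left (hnorm a) hK)
  · -- degenerate: some nonzero combination has invariant part `0` a.e., hence tube form `0`
    push Not at hdeg
    obtain ⟨a, ha, hle0⟩ := hdeg
    refine ⟨a, ha, ?_⟩
    have hGam : Measurable fun U => ∑ i, a i * G i U := measurable_combination hGm a
    obtain ⟨CG, hCG⟩ := bounded_combination hGb a
    have hint : Integrable (fun U => (∑ i, a i * G i U) * ∑ i, a i * G i U) (configMeasure SU2 L) :=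
      integrable_of_measurable_abs_le _ (hGam.mul hGam) (C := CG * CG) fun U => by
        rw [abs_mul]; exact mul_le_mul (hCG U) (hCG U) (abs_nonneg _) ((abs_nonneg _).trans (hCG U))
    have h0 : (∫ U, (∑ i, a i * G i U) * ∑ i, a i * G i U ∂configMeasure SU2 L) = 0 :=
      le_antisymm hle0 (integral_nonneg fun U => mul_self_nonneg _)
    have hae : ∀ᵐ U ∂configMeasure SU2 L, (∑ i, a i * G i U) = 0 := by
      have h := (integral_eq_zero_iff_of_nonneg (fun U => mul_self_nonneg _) hint).mp h0
      exact h.mono fun U hU => mul_self_eq_zero.mp hU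
    have hq0 : qform su2Rep β (fun U => ∑ i, a i * G i U) (fun U => ∑ i, a i * G i U) = 0 := by
      rw [qform_eq_l2_transferApply]
      unfold l2
      exact integral_eq_zero_of_ae (hae.mono fun U hU => by simp only [hU, zero_mul, Pi.zero_apply])
    rw [hform a, hq0, zero_mul]
    exact mul_nonneg hK (hGram a ha).le

/-- ★ The instance `S = {orbitDist < δ}`: INNER one-orbit at `δ` gives the support-separated soft tube statement for EVERY measurable bounded nonnegative weight bounded below on
its support — whatever its own support. [cite: Luscher1983, §3] -/
theorem softTubeNoIntruderOn_orbitDist_of_inner {δ : ℝ → ℝ} {χ : ℝ → GaugeConfig 3 L SU2 → ℝ}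
    (hχm : ∀ β, Measurable (χ β)) (hχb : ∀ β, ∃ C : ℝ, ∀ U, |χ β U| ≤ C) (hχ0 : ∀ β U, 0 ≤ χ β U)
    (hχlow : ∀ β, ∃ m : ℝ, 0 < m ∧ ∀ U, χ β U ≠ 0 → m ≤ χ β U) (hI : InnerNoIntruderOneOrbitAt L δ) :
    SoftTubeNoIntruderOn L χ (fun β => {U | orbitDist U < δ β}) :=
  softTubeNoIntruderOn_of_inner hχm hχb hχ0 hχlow ⟨0, fun _ _ _ _ hU => hU⟩ hI

-- (R27's unseparated statement `SoftTubeNoIntruderAt L χ` is the instance `S = univ`: `R27.softTubeNoIntruderAt_of_inner` together with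
-- `softTubeNoIntruderOn_univ_iff`; not restated here.)

/-! ## §2 ★★ The support-separated soft tube statement is INNER one-orbit -/

/-- ★★ **`SoftTubeNoIntruderOn L χ {orbitDist < δ} ↔ InnerNoIntruderOneOrbitAt L δ`** for every admissible nonnegative weight bounded below on its support (lane A's
`innerNoIntruderOneOrbitAt_of_softTubeOn` and §1). [cite: Luscher1983, §3] [cite: SeilerLNP1982, §2–3] -/
theorem softTubeNoIntruderOn_iff_inner {δ : ℝ → ℝ} {χ : ℝ → GaugeConfig 3 L SU2 → ℝ} (hadm : SoftTubeAdmissible L δ χ)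
    (hχ0 : ∀ β U, 0 ≤ χ β U) (hχlow : ∀ β, ∃ m : ℝ, 0 < m ∧ ∀ U, χ β U ≠ 0 → m ≤ χ β U) :
    SoftTubeNoIntruderOn L χ (fun β => {U | orbitDist U < δ β}) ↔ InnerNoIntruderOneOrbitAt L δ :=
  ⟨innerNoIntruderOneOrbitAt_of_softTubeOn hadm, softTubeNoIntruderOn_orbitDist_of_inner hadm.1 hadm.2.1 hχ0 hχlow⟩

/-! ## §3 ★ The support-separated package is the support-separated soft tube statement (trivial split) -/

/-- ★ **`SoftTubeNoIntruderOn L χ S → SoftTubeBOPackageOn L χ S`** for EVERY weight and EVERY region, by the TRIVIAL SPLIT `u = f`, `v = 0`, `θ = 1`, `b = 0`,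
`σ = e^{ελ_b/4}λ₀/μ₀` (FLOOR with equality, STIFF and OFF-DIAGONAL read `0 ≤ 0`, SLOW = the tube statement at `ε/2`) — `R27b.softTubeBOPackageAt_of_softTubeNoIntruderAt` verbatim.
[cite: Luscher1983, §3] [cite: SjostrandZworski2007, §2] -/
theorem softTubeBOPackageOn_of_softTubeNoIntruderOn {χ : ℝ → GaugeConfig 3 L SU2 → ℝ} {S : ℝ → Set (GaugeConfig 3 L SU2)} (hN : SoftTubeNoIntruderOn L χ S) :
    SoftTubeBOPackageOn L χ S := by
  intro k ε hε
  obtain ⟨β0, hβ0⟩ := hN k (ε / 2) (half_pos hε)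
  refine ⟨1, one_pos, le_rfl, max β0 1, fun β hβ => ?_⟩
  have hβ0' : β0 ≤ β := (le_max_left _ _).trans hβ
  have hβ1 : 1 ≤ β := (le_max_right _ _).trans hβ
  have hβpos : 0 < β := by linarith
  have hL0 : (0 : ℝ) < (L : ℝ) := by exact_mod_cast Nat.pos_of_ne_zero (NeZero.ne L)
  have hB : 0 < (L : ℝ) ^ 3 * β := by positivity
  have hμ0 : 0 < levelValue su2Rep 1 ((L : ℝ) ^ 3 * β) 0 := levelValue_su2Rep_pos hB 0
  have hΛ0 : 0 < levelValue su2Rep L β 0 := levelValue_zero_su2Rep_pos L β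
  have hlam0 : 0 < bareLambda ((L : ℝ) ^ 3 * β) := bareLambda_pos' hB
  set lam := bareLambda ((L : ℝ) ^ 3 * β) with hlam
  set μ0 := levelValue su2Rep 1 ((L : ℝ) ^ 3 * β) 0 with hμ0def
  set μk := levelValue su2Rep 1 ((L : ℝ) ^ 3 * β) k with hμkdef
  set Λ0 := levelValue su2Rep L β 0 with hΛ0def
  refine ⟨Real.exp (ε / 4 * lam) * Λ0 / μ0, 0, by positivity, le_rfl, ?_, ?_, ?_⟩
  · -- `b² = 0 ≤ εθλ_b/16`
    have : (0 : ℝ) ^ 2 = 0 := by norm_num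
    rw [this]; positivity
  · -- FLOOR with equality: `e^{−ελ/4}·(σμ₀) = λ₀`
    have hσμ : Real.exp (ε / 4 * lam) * Λ0 / μ0 * μ0 = Real.exp (ε / 4 * lam) * Λ0 := by
      field_simp
    rw [hσμ, ← mul_assoc, ← Real.exp_add, neg_add_cancel, Real.exp_zero, one_mul]
  · intro f hfm hfb hfs hfS hGram
    refine ⟨f, fun _ _ => 0, fun a => ?_, ?_⟩
    · -- the trivial split: `u_a = f_a`, `v_a = 0`
      simp only [mul_zero, Finset.sum_const_zero, tubeNormSq_zero_fun, tubeForm_zero_fun, zero_mul, mul_zero, add_zero, sub_self]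
      refine ⟨?_, le_rfl, le_rfl, le_rfl, le_rfl⟩
      by_cases ha : a = 0
      · rw [ha, tubeNormSq_combination_zero]
      · exact (hGram a ha).le
    · -- SLOW = the tube statement at `ε/2`
      obtain ⟨a, ha, hmain⟩ := hβ0 β hβ0' f hfm hfb hfs hfS hGram
      refine ⟨a, ha, ?_⟩
      have e2 : Real.exp (ε / 4 * lam) * (Real.exp (ε / 4 * lam) * Λ0 / μ0 * μk) = Real.exp (ε / 2 * lam) * μk * Λ0 / μ0 := by
        rw [show ε / 2 * lam = ε / 4 * lam + ε / 4 * lam by ring, Real.exp_add]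
        field_simp
      rw [e2, div_mul_eq_mul_div, le_div_iff₀ hμ0]
      exact hmain

/-- ★ **The support-separated package is the support-separated soft tube statement** (every `χ`, every `S`). [cite: Luscher1983, §3] [cite: SjostrandZworski2007, §2] -/
theorem softTubeBOPackageOn_iff (χ : ℝ → GaugeConfig 3 L SU2 → ℝ) (S : ℝ → Set (GaugeConfig 3 L SU2)) :
    SoftTubeBOPackageOn L χ S ↔ SoftTubeNoIntruderOn L χ S :=
  ⟨softTubeNoIntruderOn_of_package, softTubeBOPackageOn_of_softTubeNoIntruderOn⟩

/-- ★★ The support-separated package at `S = {orbitDist < δ}` is INNER one-orbit at `δ`, for every admissible nonnegative weight bounded below on its support.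
[cite: Luscher1983, §3] [cite: SjostrandZworski2007, §2] -/
theorem softTubeBOPackageOn_iff_inner {δ : ℝ → ℝ} {χ : ℝ → GaugeConfig 3 L SU2 → ℝ} (hadm : SoftTubeAdmissible L δ χ)
    (hχ0 : ∀ β U, 0 ≤ χ β U) (hχlow : ∀ β, ∃ m : ℝ, 0 < m ∧ ∀ U, χ β U ≠ 0 → m ≤ χ β U) :
    SoftTubeBOPackageOn L χ (fun β => {U | orbitDist U < δ β}) ↔ InnerNoIntruderOneOrbitAt L δ :=
  (softTubeBOPackageOn_iff χ _).trans (softTubeNoIntruderOn_iff_inner hadm hχ0 hχlow)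

/-! ## §4 ★★ The targets of record: the BIG record weight, test functions in the small core -/

/-- ★★ **The support-separated soft tube statement of record is INNER one-orbit at the TEST radius**: for all positive `δ ≤ δ'`, all `ρ ≥ 2δ'` and ALL `δg`,
`SoftTubeNoIntruderOn L (recordWeightRho δ' ρ δg) {orbitDist < δ} ↔ InnerNoIntruderOneOrbitAt L δ`. [cite: Luscher1983, §3] -/
theorem softTubeOn_bigRecordWeightRho_iff_inner {δ δ' ρ : ℝ → ℝ} (hδ : ∀ β, 0 < δ β) (hδδ' : ∀ β, δ β ≤ δ' β) (hρ : ∀ β, 2 * δ' β ≤ ρ β)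
    (δg : ℝ → ℝ) :
    SoftTubeNoIntruderOn L (recordWeightRho L δ' ρ δg) (fun β => {U | orbitDist U < δ β}) ↔ InnerNoIntruderOneOrbitAt L δ :=
  softTubeNoIntruderOn_iff_inner
    (softTubeAdmissible_mono hδδ' (softTubeAdmissible_recordWeightRho L (fun β => (hδ β).trans_le (hδδ' β)) hρ))
    (fun β U => recordWeightRho_nonneg δ' ρ δg β U)
    (fun β => ⟨_, Real.exp_pos _, fun _ hU => recordWeightRho_ge_of_ne_zero δ' ρ δg β hU⟩)

/-- ★★ **Lane A's support-separated target of record is INNER one-orbit at the test radius**: for all positive `δ ≤ δ'`, all `ρ ≥ 2δ'`, ALL `δg`,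
`SoftTubeBOPackageOn L (recordWeightRho δ' ρ δg) {orbitDist < δ} ↔ InnerNoIntruderOneOrbitAt L δ`. [cite: Luscher1983, §3] [cite: SjostrandZworski2007, §2] -/
theorem softTubeBOPackageOn_bigRecordWeightRho_iff_inner {δ δ' ρ : ℝ → ℝ} (hδ : ∀ β, 0 < δ β) (hδδ' : ∀ β, δ β ≤ δ' β)
    (hρ : ∀ β, 2 * δ' β ≤ ρ β) (δg : ℝ → ℝ) :
    SoftTubeBOPackageOn L (recordWeightRho L δ' ρ δg) (fun β => {U | orbitDist U < δ β}) ↔ InnerNoIntruderOneOrbitAt L δ :=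
  (softTubeBOPackageOn_iff _ _).trans (softTubeOn_bigRecordWeightRho_iff_inner hδ hδδ' hρ δg)

/-- ★★ **The power-scale instance**: test core `β^{−s}`, weight radius `c·β^{−s}` (`c ≥ 1`; lane A: `c = 3`), fat radius `M·β^{−s}` (`M ≥ 2c`; lane A: `M ≥ 6`), gauge width
`β^{−t}` — INNER one-orbit at `β^{−s}` for EVERY `t`, `c`, `M`. [cite: Luscher1983, §3] -/
theorem softTubeBOPackageOn_pow_iff (s t c M : ℝ) (hc : 1 ≤ c) (hM : 2 * c ≤ M) :
    SoftTubeBOPackageOn L (recordWeightRho L (fun β => c * powScale s β) (fun β => M * powScale s β) (powScale t))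
        (fun β => {U | orbitDist U < powScale s β}) ↔ InnerNoIntruderOneOrbitAt L (powScale s) :=
  softTubeBOPackageOn_bigRecordWeightRho_iff_inner (fun β => powScale_pos s β)
    (fun β => by nlinarith [powScale_pos s β])
    (fun β => by nlinarith [powScale_pos s β]) (powScale t)

/-- ★★ Lane A's literal instance (`c = 3`, `M ≥ 6`): `SoftTubeBOPackageOn L (recordWeightRho (3β^{−s}) (Mβ^{−s}) (β^{−t})) {orbitDist < β^{−s}} ↔ InnerNoIntruderOneOrbitAt L (powScale s)`
— the converse of `innerNoIntruderOneOrbitAt_pow_of_bigRecordWeight_packageOn`. [cite: Luscher1983, §3] -/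
theorem softTubeBOPackageOn_pow_iff_three (s t M : ℝ) (hM : 6 ≤ M) :
    SoftTubeBOPackageOn L (recordWeightRho L (fun β => 3 * powScale s β) (fun β => M * powScale s β) (powScale t))
        (fun β => {U | orbitDist U < powScale s β}) ↔ InnerNoIntruderOneOrbitAt L (powScale s) :=
  softTubeBOPackageOn_pow_iff s t 3 M (by norm_num) (by linarith)

/-- ★ **The support separation is decorative in the typed target**: the separated target of record is EQUIVALENT to the unseparated free-radius target (R31; any `t'`, any
`M' ≥ 2`). [cite: Luscher1983, §3] -/
theorem softTubeBOPackageOn_pow_iff_packageAt_recordWeightRho (s t t' M M' : ℝ) (hM : 6 ≤ M) (hM' : 2 ≤ M') :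
    SoftTubeBOPackageOn L (recordWeightRho L (fun β => 3 * powScale s β) (fun β => M * powScale s β) (powScale t))
        (fun β => {U | orbitDist U < powScale s β}) ↔
      SoftTubeBOPackageAt L (recordWeightRho L (powScale s) (fun β => M' * powScale s β) (powScale t')) :=
  (softTubeBOPackageOn_pow_iff_three s t M hM).trans (softTubeBOPackage_recordWeightRho_pow_iff s t' M' hM').symm

/-- ★ … and to the original weight of record `recordWeight (powScale s) (powScale t')` (R27b; any `t'`). [cite: Luscher1983, §3] -/
theorem softTubeBOPackageOn_pow_iff_packageAt_recordWeight (s t t' M : ℝ) (hM : 6 ≤ M) :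
    SoftTubeBOPackageOn L (recordWeightRho L (fun β => 3 * powScale s β) (fun β => M * powScale s β) (powScale t))
        (fun β => {U | orbitDist U < powScale s β}) ↔
      SoftTubeBOPackageAt L (recordWeight L (powScale s) (powScale t')) :=
  (softTubeBOPackageOn_pow_iff_three s t M hM).trans (softTubeBOPackage_recordWeight_pow_iff s t').symm

/-- ★ … and to R18's `InnerBOPackageAt L (powScale s)`: all SIX typed C4-CORE interfaces coincide. [cite: Luscher1983, §3] [cite: SjostrandZworski2007, §2] -/
theorem softTubeBOPackageOn_pow_iff_innerBOPackage (s t M : ℝ) (hM : 6 ≤ M) :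
    SoftTubeBOPackageOn L (recordWeightRho L (fun β => 3 * powScale s β) (fun β => M * powScale s β) (powScale t))
        (fun β => {U | orbitDist U < powScale s β}) ↔ InnerBOPackageAt L (powScale s) :=
  (softTubeBOPackageOn_pow_iff_three s t M hM).trans (R18.innerBOPackageAt_iff (powScale s)).symm

/-- ★ WIDTH/RADIUS IRRELEVANCE by name: two separated targets of record with different `(t, M)` are equivalent. [cite: Luscher1983, §3] -/
theorem softTubeBOPackageOn_pow_params_irrel (s t t' M M' : ℝ) (hM : 6 ≤ M) (hM' : 6 ≤ M') :
    SoftTubeBOPackageOn L (recordWeightRho L (fun β => 3 * powScale s β) (fun β => M * powScale s β) (powScale t))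
        (fun β => {U | orbitDist U < powScale s β}) ↔
      SoftTubeBOPackageOn L (recordWeightRho L (fun β => 3 * powScale s β) (fun β => M' * powScale s β) (powScale t'))
        (fun β => {U | orbitDist U < powScale s β}) :=
  (softTubeBOPackageOn_pow_iff_three s t M hM).trans (softTubeBOPackageOn_pow_iff_three s t' M' hM').symm

end Summit.QuantumFields.YangMills.Theorems.TwistedTraceScaling.Negative.R34

end
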